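import Summits.Ventures.PercRepro.Conjectures

/-!
# PercRepro — single-merge concavity (SMC): the statement layer (typer-2, gen 2)

Typing of Theorem 7 of `proofs/P4-pairsum.md` (p4; PLAN.md §3 D1 / §9) — the principle behind the
pair-sum inequality C-004 — and of the **SMC cone** whose every element is a theorem with its proof
attached. Two levels:

* **General `k`** (partitions of the marked indices as `Setoid (Fin k)`, refinement order):
  `mergeBlocks σ i j` (merge the blocks of `i` and `j`), `IsSingleMerge σ τ` (the covering pairs
  of the refinement order: `τ` arises from `σ` by merging two distinct blocks), the condition
  `SMC A` on a kernel `A : Setoid (Fin k) → Setoid (Fin k) → ℝ`, the quadratic form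
  `G.quadForm p m A = Σ_{ω,ω'} w(ω) w(ω') A(Π(ω), Π(ω'))` (= `Σ_{σ,τ} A σ τ π_σ π_τ` at the law `π`
  of the marked partition, `quadForm_eq_sum_law`), and the principle `SMCPrinciple k` as a named
  Prop: `SMC A → 0 ≤ Q_A(π_{G,p,m})` for every finite multigraph, every `p ∈ [0,1]^E`, every marking.
* **`k = 3`, decidable** (the engine's five law rows `abc, ab|c, ac|b, bc|a, a|b|c` = `Fin 5` in
  restricted-growth-string order): `rgs3`, `G.law3 p a b c : Fin 5 → ℝ`, the six single merges
  `singleMerges3`, the DECIDABLE predicate `SMC3 A` on integer kernels `Matrix (Fin 5) (Fin 5) ℤ` (a rational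
  ray is scaled to an integer one; the cone condition is homogeneous),
  the quadratic form `quadForm3`, the principle `SMC3Principle` (named Prop), the pair-sum kernel
  `A_PS` with `SMC3 A_PS` checked by `decide`, and `C004_of_SMC3Principle` (the pair-sum inequality
  is the instance `A_PS` of the principle). The same layer for `k = 4` (`Fin 15`, 31 single
  merges) is `SMC4.lean`.

Nothing here proves the principle itself (p4/p6, PLAN.md §9); the certificate pipeline
(`SMC3 A` by `decide`) is p5's. The two levels are linked by the classification of
`Setoid (Fin 3)` into the five rows (p5's Part(M)-as-Fintype layer).
-/

namespace PercRepro

open Finset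

/-! ### General `k`: single merges and the SMC condition on a kernel -/

section General

variable {k : ℕ}

/-- The partition obtained from `σ` by merging the blocks of `i` and `j`:
`x ~ y` iff `σ x y`, or `x ~ i` and `j ~ y`, or `x ~ j` and `i ~ y` (in `σ`). This is exactly the
shape of typer-1's contraction lemma `conn_update_true_iff` (opening one edge). -/
def mergeBlocks (σ : Setoid (Fin k)) (i j : Fin k) : Setoid (Fin k) where
  r x y := σ x y ∨ (σ x i ∧ σ j y) ∨ (σ x j ∧ σ i y)
  iseqv :=
    { refl := fun x => Or.inl (σ.refl x)
      symm := by
        rintro x y (h | ⟨h1, h2⟩ | ⟨h1, h2⟩)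
        · exact Or.inl (σ.symm h)
        · exact Or.inr (Or.inr ⟨σ.symm h2, σ.symm h1⟩)
        · exact Or.inr (Or.inl ⟨σ.symm h2, σ.symm h1⟩)
      trans := by
        rintro x y z (h | ⟨h1, h2⟩ | ⟨h1, h2⟩) (h' | ⟨h1', h2'⟩ | ⟨h1', h2'⟩)
        · exact Or.inl (σ.trans h h')
        · exact Or.inr (Or.inl ⟨σ.trans h h1', h2'⟩)
        · exact Or.inr (Or.inr ⟨σ.trans h h1', h2'⟩)
        · exact Or.inr (Or.inl ⟨h1, σ.trans h2 h'⟩)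
        · exact Or.inl (σ.trans h1 (σ.trans (σ.symm (σ.trans h2 h1')) h2'))
        · exact Or.inl (σ.trans h1 h2')
        · exact Or.inr (Or.inr ⟨h1, σ.trans h2 h'⟩)
        · exact Or.inl (σ.trans h1 h2')
        · exact Or.inl (σ.trans h1 (σ.trans (σ.symm (σ.trans h2 h1')) h2')) }

/-- Reading off the relation of a merge. -/
theorem mergeBlocks_rel (σ : Setoid (Fin k)) (i j x y : Fin k) :
    mergeBlocks σ i j x y ↔ σ x y ∨ (σ x i ∧ σ j y) ∨ (σ x j ∧ σ i y) := Iff.rfl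

/-- Merging only coarsens. -/
theorem le_mergeBlocks (σ : Setoid (Fin k)) (i j : Fin k) : σ ≤ mergeBlocks σ i j :=
  Setoid.le_def.2 fun h => Or.inl h

/-- `i` and `j` are related after the merge. -/
theorem mergeBlocks_rel_self (σ : Setoid (Fin k)) (i j : Fin k) : mergeBlocks σ i j i j :=
  Or.inr (Or.inl ⟨σ.refl i, σ.refl j⟩)

/-- Merging two indices that are already in one block changes nothing. -/
theorem mergeBlocks_of_rel {σ : Setoid (Fin k)} {i j : Fin k} (h : σ i j) :
    mergeBlocks σ i j = σ := by
  refine le_antisymm (Setoid.le_def.2 ?_) (le_mergeBlocks σ i j)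
  rintro x y (hxy | ⟨h1, h2⟩ | ⟨h1, h2⟩)
  · exact hxy
  · exact σ.trans h1 (σ.trans h h2)
  · exact σ.trans h1 (σ.trans (σ.symm h) h2)

/-- `(σ, τ)` is a **single merge**: `τ` arises from `σ` by merging two DISTINCT blocks (the
covering pairs of the refinement order on partitions; the canonical name of the notion, typer-1's
ruling of 2026-08-22T01:41:56Z — a non-strict variant allowing `τ = σ` must use another name). -/
def IsSingleMerge (σ τ : Setoid (Fin k)) : Prop :=
  ∃ i j : Fin k, ¬ σ i j ∧ τ = mergeBlocks σ i j

/-- **The SMC condition** (`proofs/P4-pairsum.md` Theorem 7, hypotheses (i)–(ii)) on a kernel `A`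
indexed by partitions of the `k` marked indices: (i) `A σ σ ≥ 0` for every `σ`;
(ii) `A(e_τ - e_σ, e_τ' - e_σ') ≤ 0` for all single merges `(σ, τ)`, `(σ', τ')` (including
`(σ', τ') = (σ, τ)`). Symmetry of `A` is not required (the proof never uses it). -/
structure SMC (A : Setoid (Fin k) → Setoid (Fin k) → ℝ) : Prop where
  diag_nonneg : ∀ σ, 0 ≤ A σ σ
  merge_nonpos : ∀ σ τ σ' τ', IsSingleMerge σ τ → IsSingleMerge σ' τ' →
    A τ τ' - A τ σ' - A σ τ' + A σ σ' ≤ 0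

end General

/-! ### The quadratic form of a kernel at the law of the marked partition -/

namespace MultiGraph

variable {V E : Type*} (G : MultiGraph V E) [Fintype E] [DecidableEq E] {k : ℕ}

/-- The quadratic form `Q_A(π) = Σ_{σ,τ} A σ τ π_σ π_τ` of the kernel `A` at the law
`π = π_{G,p,m}` of the marked partition, written as a double sum over configurations
(`= Σ_{ω,ω'} w(ω) w(ω') A(Π(ω), Π(ω'))`, see `quadForm_eq_sum_law`). -/
noncomputable def quadForm (p : E → ℝ) {k : ℕ} (m : Fin k → V)
    (A : Setoid (Fin k) → Setoid (Fin k) → ℝ) : ℝ :=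
  ∑ ω : Config E, ∑ ω' : Config E,
    weight p ω * weight p ω' * A (G.markedPartition ω m) (G.markedPartition ω' m)

/-- One law row as a sum over configurations. -/
theorem prob_partitionSetoidEvent_eq_sum [DecidableEq (Setoid (Fin k))] (p : E → ℝ)
    (m : Fin k → V) (σ : Setoid (Fin k)) :
    prob p (G.partitionSetoidEvent m σ) =
      ∑ ω : Config E, if G.markedPartition ω m = σ then weight p ω else 0 := by
  unfold prob
  refine Finset.sum_congr rfl fun ω _ => ?_
  by_cases h : G.markedPartition ω m = σ <;> simp [Set.indicator, partitionSetoidEvent, h]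

/-- Summing a function of the partition against the law rows of a finite set `S` containing
every value of the marked partition is the expectation of that function. -/
theorem sum_prob_partitionSetoidEvent_mul [DecidableEq (Setoid (Fin k))] (p : E → ℝ)
    (m : Fin k → V) (S : Finset (Setoid (Fin k))) (hS : ∀ ω : Config E, G.markedPartition ω m ∈ S)
    (B : Setoid (Fin k) → ℝ) :
    ∑ σ ∈ S, prob p (G.partitionSetoidEvent m σ) * B σ =
      ∑ ω : Config E, weight p ω * B (G.markedPartition ω m) := by
  simp_rw [G.prob_partitionSetoidEvent_eq_sum p m, Finset.sum_mul]
  rw [Finset.sum_comm]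
  refine Finset.sum_congr rfl fun ω _ => ?_
  rw [Finset.sum_eq_single (G.markedPartition ω m)]
  · simp
  · intro σ _ hσ
    simp [Ne.symm hσ]
  · intro h
    exact absurd (hS ω) h

/-- `Q_A` at the law: for any finite set `S` of partitions containing every value of the marked
partition, `G.quadForm p m A = Σ_{σ ∈ S} Σ_{τ ∈ S} A σ τ · π_σ · π_τ` with
`π_σ = P(Π = σ) = prob p (G.partitionSetoidEvent m σ)`. -/
theorem quadForm_eq_sum_law [DecidableEq (Setoid (Fin k))] (p : E → ℝ) (m : Fin k → V)
    (A : Setoid (Fin k) → Setoid (Fin k) → ℝ) (S : Finset (Setoid (Fin k)))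
    (hS : ∀ ω : Config E, G.markedPartition ω m ∈ S) :
    G.quadForm p m A = ∑ σ ∈ S, ∑ τ ∈ S, A σ τ *
      prob p (G.partitionSetoidEvent m σ) * prob p (G.partitionSetoidEvent m τ) := by
  unfold quadForm
  have h1 : ∀ σ, ∑ τ ∈ S, A σ τ * prob p (G.partitionSetoidEvent m σ) *
      prob p (G.partitionSetoidEvent m τ) =
      prob p (G.partitionSetoidEvent m σ) *
        ∑ ω' : Config E, weight p ω' * A σ (G.markedPartition ω' m) := by
    intro σ
    rw [← G.sum_prob_partitionSetoidEvent_mul p m S hS (fun τ => A σ τ), Finset.mul_sum]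
    exact Finset.sum_congr rfl fun τ _ => by ring
  simp_rw [h1]
  rw [G.sum_prob_partitionSetoidEvent_mul p m S hS
    (fun σ => ∑ ω' : Config E, weight p ω' * A σ (G.markedPartition ω' m))]
  refine Finset.sum_congr rfl fun ω _ => ?_
  rw [Finset.mul_sum]
  exact Finset.sum_congr rfl fun ω' _ => by ring

end MultiGraph

/-- **The SMC principle** (`proofs/P4-pairsum.md` Theorem 7; PLAN.md §3 D1, §9 p4) for `k` marked
vertices, as a named Prop: for every kernel `A` satisfying `SMC A`, `Q_A(π_{G,p,m}) ≥ 0` for every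
finite multigraph `G`, every `p ∈ [0,1]^E` and every marking `m : Fin k → V` (no injectivity
needed: the transition of the marked partition when one edge opens is the identity or a single
merge whatever `m` is). -/
def SMCPrinciple (k : ℕ) : Prop :=
  ∀ {V E : Type} [Fintype E] [DecidableEq E] (G : MultiGraph V E) (p : E → ℝ), IsProb p →
    ∀ (m : Fin k → V) (A : Setoid (Fin k) → Setoid (Fin k) → ℝ), SMC A → 0 ≤ G.quadForm p m A

/-! ### C-006: Gladkov's strong FKG inequality in partition form, any `k` (calibration row) -/

open Classical in
/-- The number of blocks of a partition of the `k` marked indices. -/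
noncomputable def numBlocks {k : ℕ} (σ : Setoid (Fin k)) : ℕ := Fintype.card (Quotient σ)

/-- The one-block partition has one block. -/
theorem numBlocks_top (k : ℕ) [NeZero k] : numBlocks (⊤ : Setoid (Fin k)) = 1 := by
  classical
  unfold numBlocks
  rw [Fintype.card_eq_one_iff]
  exact ⟨Quotient.mk _ 0, fun x => Quotient.inductionOn x fun a => Quotient.sound trivial⟩

/-- The discrete partition has `k` blocks. -/
theorem numBlocks_bot (k : ℕ) : numBlocks (⊥ : Setoid (Fin k)) = k := by
  classical
  unfold numBlocks
  have hb : Function.Bijective (Quotient.mk (⊥ : Setoid (Fin k))) := by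
    refine ⟨fun a b h => ?_, Quotient.mk_surjective⟩
    exact Quotient.exact h
  rw [← Fintype.card_of_bijective hb, Fintype.card_fin]

/-- A partition of `k` indices has at most `k` blocks. -/
theorem numBlocks_le {k : ℕ} (σ : Setoid (Fin k)) : numBlocks σ ≤ k := by
  classical
  unfold numBlocks
  calc Fintype.card (Quotient σ) ≤ Fintype.card (Fin k) :=
        Fintype.card_le_of_surjective _ Quotient.mk_surjective
    _ = k := Fintype.card_fin k

open Classical in
/-- The kernel of C-006 (doubled): `Q = 2·(π(⊤)·P(≥ 3 blocks) − Σ_{σ ≠ τ two-block} π(σ)π(τ))`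
(unordered pairs). At `k = 4` this is `A_PS4` of `SMC4.lean` in row form. -/
noncomputable def A_C006 (k : ℕ) : Setoid (Fin k) → Setoid (Fin k) → ℝ := fun σ τ =>
  (if σ = ⊤ ∧ 3 ≤ numBlocks τ then 1 else 0) + (if 3 ≤ numBlocks σ ∧ τ = ⊤ then 1 else 0) -
    (if σ ≠ τ ∧ numBlocks σ = 2 ∧ numBlocks τ = 2 then 1 else 0)

/-- **C-006** (mine-2's PS_k, `mining/mine-2/PSK.md`; CONJECTURES.md v5: KNOWN = Gladkov BLMS 2024
Thm 2.1 with the label map `⊤ ↦ a`, each two-block partition ↦ itself, `≥ 3` blocks `↦ b`; `k = 3` is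
C-004): for `k` marked vertices, `π(⊤)·P(Π has ≥ 3 blocks) ≥ Σ_{σ ≠ τ two-block} π(σ)π(τ)`, stated
as the nonnegativity of the quadratic form of `A_C006 k` at the law of the marked partition
(`quadForm_eq_sum_law` turns it into the row form over any finite set of partitions; at `k = 4` it is
`pairSum4_holds`, the kernel `A_PS4`). -/
def C006 (k : ℕ) : Prop :=
  ∀ {V E : Type} [Fintype E] [DecidableEq E] (G : MultiGraph V E) (p : E → ℝ), IsProb p →
    ∀ m : Fin k → V, 0 ≤ G.quadForm p m (A_C006 k)

/-! ### `k = 3`: the engine's five law rows and the decidable SMC cone -/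

/-- The five partitions of the marked line `a b c` as restricted-growth strings, in the engine's
row order: `0 = abc` (`000`), `1 = ab|c` (`001`), `2 = ac|b` (`010`), `3 = bc|a` (`011`),
`4 = a|b|c` (`012`). -/
def rgs3 : Fin 5 → Fin 3 → ℕ := ![![0, 0, 0], ![0, 0, 1], ![0, 1, 0], ![0, 1, 1], ![0, 1, 2]]

/-- The six single merges (covering pairs) of the partition lattice of `{a, b, c}`:
`a|b|c → ab|c, ac|b, bc|a` and `ab|c, ac|b, bc|a → abc`, as pairs `(σ, τ)` of row indices. -/
def singleMerges3 : Finset (Fin 5 × Fin 5) := {(4, 1), (4, 2), (4, 3), (1, 0), (2, 0), (3, 0)}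

/-- **The SMC condition at `k = 3`** on an integer kernel (a `5 × 5` matrix in row order; a
rational ray is scaled to integers): (i) nonnegative diagonal, (ii) `A(e_τ - e_σ, e_τ' - e_σ') ≤ 0`
for all single merges `(σ, τ), (σ', τ')`. Decidable: certificates are checked by `decide`. -/
def SMC3 (A : Matrix (Fin 5) (Fin 5) ℤ) : Prop :=
  (∀ s, 0 ≤ A s s) ∧
    ∀ st ∈ singleMerges3, ∀ st' ∈ singleMerges3,
      A st.2 st'.2 - A st.2 st'.1 - A st.1 st'.2 + A st.1 st'.1 ≤ 0

/-- `SMC3` is decidable (unfold and decide the finite conjunction). -/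
instance : DecidablePred SMC3 := fun _ => by unfold SMC3; infer_instance

/-- The quadratic form `Σ_{s,t} A s t · π s · π t` of an integer `5 × 5` kernel at a law vector. -/
def quadForm3 (A : Matrix (Fin 5) (Fin 5) ℤ) (π : Fin 5 → ℝ) : ℝ :=
  ∑ s, ∑ t, (A s t : ℝ) * π s * π t

namespace MultiGraph

variable {V E : Type*} (G : MultiGraph V E) [Fintype E] [DecidableEq E]

/-- The law of the marked partition of `a, b, c` as the engine's row vector:
`law3 s = P(Π = row s)` (`x, y₁, y₂, y₃, z` of `proofs/P4-pairsum.md` §1). -/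
noncomputable def law3 (p : E → ℝ) (a b c : V) : Fin 5 → ℝ :=
  fun s => prob p (G.partitionEvent ![a, b, c] (rgs3 s))

/-- Row `0`: `x = P(a~b~c)`. -/
theorem law3_zero (p : E → ℝ) (a b c : V) :
    G.law3 p a b c 0 = prob p (G.partitionEvent ![a, b, c] ![0, 0, 0]) := rfl

/-- Row `1`: `y₁ = P(ab|c)`. -/
theorem law3_one (p : E → ℝ) (a b c : V) :
    G.law3 p a b c 1 = prob p (G.partitionEvent ![a, b, c] ![0, 0, 1]) := rfl

/-- Row `2`: `y₂ = P(ac|b)`. -/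
theorem law3_two (p : E → ℝ) (a b c : V) :
    G.law3 p a b c 2 = prob p (G.partitionEvent ![a, b, c] ![0, 1, 0]) := rfl

/-- Row `3`: `y₃ = P(bc|a)`. -/
theorem law3_three (p : E → ℝ) (a b c : V) :
    G.law3 p a b c 3 = prob p (G.partitionEvent ![a, b, c] ![0, 1, 1]) := rfl

/-- Row `4`: `z = P(a|b|c)`. -/
theorem law3_four (p : E → ℝ) (a b c : V) :
    G.law3 p a b c 4 = prob p (G.partitionEvent ![a, b, c] ![0, 1, 2]) := rfl

end MultiGraph

/-- **The SMC principle at `k = 3`** as a named Prop (the form the certificate pipeline consumes,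
PLAN.md §9 p4/p5): every `SMC3` kernel gives a nonnegative quadratic form at every law. -/
def SMC3Principle : Prop :=
  ∀ A : Matrix (Fin 5) (Fin 5) ℤ, SMC3 A →
    ∀ {V E : Type} [Fintype E] [DecidableEq E] (G : MultiGraph V E) (p : E → ℝ), IsProb p →
      ∀ a b c : V, 0 ≤ quadForm3 A (G.law3 p a b c)

/-- The pair-sum kernel (`proofs/P4-pairsum.md` §7, scaled by `2`): `A_{TB} = A_{BT} = 1`,
`A_{P_i P_j} = -1` for `i ≠ j`, all other entries `0`;
`Q_{A_PS}(π) = 2·(xz - (y₁y₂ + y₁y₃ + y₂y₃))`. -/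
def A_PS : Matrix (Fin 5) (Fin 5) ℤ :=
  !![0, 0, 0, 0, 1;
     0, 0, -1, -1, 0;
     0, -1, 0, -1, 0;
     0, -1, -1, 0, 0;
     1, 0, 0, 0, 0]

/-- The pair-sum kernel satisfies the SMC condition (kernel-checked certificate). -/
theorem SMC3_A_PS : SMC3 A_PS := by decide

/-- The quadratic form of the pair-sum kernel is twice the pair-sum defect. -/
theorem quadForm3_A_PS (π : Fin 5 → ℝ) :
    quadForm3 A_PS π = 2 * (π 0 * π 4 - (π 1 * π 2 + π 1 * π 3 + π 2 * π 3)) := by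
  simp only [quadForm3, A_PS, Fin.sum_univ_succ, Fin.sum_univ_zero, Matrix.of_apply,
    Matrix.cons_val_zero, Matrix.cons_val_succ, Fin.succ_zero_eq_one, Fin.succ_one_eq_two]
  push_cast
  ring

/-- **Positive control**: Harris for the two up-sets `{a~b} = {abc, ab|c}` and `{a~c} = {abc, ac|b}`,
homogenised as the kernel `A s t = [s = abc] - [s ∈ {a~b}]·[t ∈ {a~c}]`
(`Q_A(π) = x·Σπ - π(a~b)·π(a~c)`), lies in the SMC cone (`proofs/P4-pairsum.md` §7). -/
def A_harris3 : Matrix (Fin 5) (Fin 5) ℤ := fun s t =>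
  (if s = 0 then 1 else 0) - (if s = 0 ∨ s = 1 then 1 else 0) * (if t = 0 ∨ t = 2 then 1 else 0)

/-- The Harris kernel is in the `k = 3` cone (positive control). -/
theorem SMC3_A_harris3 : SMC3 A_harris3 := by decide

/-- **Negative control**: the reversed pair-sum kernel is NOT in the SMC cone. -/
theorem not_SMC3_neg_A_PS : ¬ SMC3 (-A_PS) := by decide

/-- **C-004 is the instance `A_PS` of the SMC principle at `k = 3`.** -/
theorem C004_of_SMC3Principle (h : SMC3Principle) : C004 := by
  intro V E _ _ G p hp a b c _
  have := h A_PS SMC3_A_PS G p hp a b c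
  rw [quadForm3_A_PS, G.law3_zero, G.law3_one, G.law3_two, G.law3_three, G.law3_four] at this
  linarith

/-! ### C-012 and C-013 (mine-1's M1-F2 / M1-F5): graph-specific degree-2 rows at `k = 3` -/

/-- **C-012** (mine-1's M1-F2, `conjectures/MINE-1.md` §C; C-id lead 2026-08-22T03:52Z): on the
five rows `x = P(abc), y₁ = P(ab|c), y₂ = P(ac|b), y₃ = P(bc|a), z = P(a|b|c)` of the marked
triple `(a, b, c)`, `(z + y₁)(y₂ + x) ≤ (y₁ + y₂ + y₃)(x + z)`, i.e.
`P(c ≁ a ∧ c ≁ b) · P(a ~ c) ≤ P(exactly one pair connected) · P(all or none connected)` — an UPPER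
bound on `P(abc)·P(a|b|c)` (C-004 is the lower bound). FALSE in the abstract single-merge model
(graph-specific); outside the known cone at every degree (exact Farkas). -/
def C012 : Prop :=
  ∀ {V E : Type} [Fintype E] [DecidableEq E] (G : MultiGraph V E) (p : E → ℝ), IsProb p →
    ∀ a b c : V,
      (G.law3 p a b c 4 + G.law3 p a b c 1) * (G.law3 p a b c 2 + G.law3 p a b c 0) ≤
        (G.law3 p a b c 1 + G.law3 p a b c 2 + G.law3 p a b c 3) *
          (G.law3 p a b c 0 + G.law3 p a b c 4)

/-- **C-013** (mine-1's M1-F5; C-id lead 2026-08-22T03:52Z): on the same rows,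
`(z + y₁ + y₂)(y₃ + x) ≤ (y₁ + y₂ + y₃)(z + y₁ + x)`, i.e.
`P(b ≁ c) · P(b ~ c) ≤ P(exactly one pair connected) · P([a ~ c] = [b ~ c])` — the variance of
`1[b ~ c]` bounded by `P(one pair) · P(a and b agree about c)`. Sibling of C-012 (same scope, same
graph-specificity and Farkas independence). -/
def C013 : Prop :=
  ∀ {V E : Type} [Fintype E] [DecidableEq E] (G : MultiGraph V E) (p : E → ℝ), IsProb p →
    ∀ a b c : V,
      (G.law3 p a b c 4 + G.law3 p a b c 1 + G.law3 p a b c 2) *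
          (G.law3 p a b c 3 + G.law3 p a b c 0) ≤
        (G.law3 p a b c 1 + G.law3 p a b c 2 + G.law3 p a b c 3) *
          (G.law3 p a b c 4 + G.law3 p a b c 1 + G.law3 p a b c 0)

/-- **M1-H** (mine-1, a note: implied by C-012): `x·z ≤ β(1 − β)` with `β = P(exactly one pair)`,
here with `1 − β = x + z` written out: `x·z ≤ (y₁ + y₂ + y₃)(x + z)`. -/
def M1H : Prop :=
  ∀ {V E : Type} [Fintype E] [DecidableEq E] (G : MultiGraph V E) (p : E → ℝ), IsProb p →
    ∀ a b c : V,
      G.law3 p a b c 0 * G.law3 p a b c 4 ≤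
        (G.law3 p a b c 1 + G.law3 p a b c 2 + G.law3 p a b c 3) *
          (G.law3 p a b c 0 + G.law3 p a b c 4)

/-- C-012 implies M1-H (the rows are nonnegative). -/
theorem M1H_of_C012 (h : C012) : M1H := by
  intro V E _ _ G p hp a b c
  have key := h G p hp a b c
  have h1 : 0 ≤ G.law3 p a b c 1 := prob_nonneg hp _
  have h2 : 0 ≤ G.law3 p a b c 2 := prob_nonneg hp _
  have h0 : 0 ≤ G.law3 p a b c 0 := prob_nonneg hp _
  have h4 : 0 ≤ G.law3 p a b c 4 := prob_nonneg hp _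
  nlinarith [mul_nonneg h1 h2, mul_nonneg h4 h2, mul_nonneg h1 h0]

end PercRepro
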